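/-
Copyright (c) 2026 the pub-hodgecm-mathlib formalisation cell (harness21).  Prover seat hodgecm-mathlib-R90-C131-p02 (g0) (R90-TF S4 hand lent to L1
by CHAIR VALVE WORD W4), Track B «K2-LIT», hLiu418 = `stmt-HodgeConjecture-24832`; LEAD F0P6-plan (g14) BATCH #87 (2) (K1a-3-arch) + #152 (2) «(3c) VALUE
producer»; K1-a♮ line lead K2E5-p16 (g8) WORD #4 (3) «Φ-ROAD».  THEOREMS ONLY (no `def`, no instance, no notation, no named-fact hypothesis, no `sorry`);
lane `--supports stmt-HodgeConjecture-24832 --as helper`.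
-/
import Summits.HodgeConjecture.HodgeConjecture.Theorems.K2LiuArchTwistedIntertwiningScalarSection   -- ★ (3c) `twistedArchIntertwining_archScalarSection_eq`
import Summits.HodgeConjecture.HodgeConjecture.Theorems.K2LiuHermTwoEtaRankOneReduction            -- ★ ED. 1–2 `etaTwo_rankOne_eq`, `posSemidef_hermTwo_rankOne`
import Summits.HodgeConjecture.HodgeConjecture.Theorems.K2LiuHermTwoEtaRankOneContinuation         -- ★ ED. 3b `exists_continuation_jIntegral_line`
import Summits.HodgeConjecture.HodgeConjecture.Theorems.K2LiuHermTwoXiEtaIdentitySemidefinite       -- ★ `xiTwo_eq_etaTwo_of_posSemidef`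
import Summits.HodgeConjecture.HodgeConjecture.Theorems.K2LiuHermTwoConfluentXiHolomorphy           -- ★ `differentiableOn_xiTwo_diag`
import Summits.HodgeConjecture.HodgeConjecture.Theorems.K2LiuLocalKernelArchPlaceFactor              -- ★ `differentiableOn_Gamma_two_mul`
import Mathlib.Analysis.Complex.Convex
import HarnessLib

/-!
# Crux `HLiu418`, KIND 1 a♮ (K1a-3-arch), (3c-cont): the TWISTED archimedean big-cell block of the scalar `K_w`-type at a RANK-ONE index is
# HOLOMORPHIC ON `{0 < re s}` — `∃ E` holomorphic there with `block(s) = E(s)` on `{½ < re s}` (★ FILE 10's ∃-shape, singular term)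

Cell `hodgecm-mathlib`, crux item hLiu418 = `stmt-HodgeConjecture-24832` (helper lane, count-neutral).  The assembly of this seat's Φ-road files:
★ (3c) `twistedArchIntertwining_archScalarSection_eq` (block `= det d^{−k}|det d|^{k−2s−2}·e(τ(TU))·⅛·ξ₂(V, T; α, β)`, `α = s+1+k/2`, `β = s+1−k/2`),
★ `differentiableOn_xiTwo_diag` (the block is holomorphic on `{½ < re s}` as it stands), ★ `xiTwo_eq_etaTwo_of_posSemidef` (`re α > 3`, `re β > 1`),
the unimodular COVARIANCE of `η` (§1 `etaTwo_conj`: `η(g, aTaᴴ) = η(aᴴga, T)`, rotating the rank-one index to `diag(t,0)`), ★ ED. 2 `etaTwo_rankOne_eq`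
(`η₂ = (π/p)e^{−pt}(1/q′)^{α+β−2}Γ(α+β−2)·J`), ★ ED. 3b `exists_continuation_jIntegral_line` (`Γ(β−1)⁻¹J` continues to `{1 − N < re β}`), and the
IDENTITY THEOREM on the half-plane `{½ < re s}` (Mathlib `AnalyticOnNhd.eqOn_of_preconnected_of_eventuallyEq`, `convex_halfSpace_re_gt`).
* §1 `etaTwo_conj`; §2 letters (`posSemidef_conj_rankOne`, holomorphy of the prefactors); §3 **`twistedArchBlock_scalarType_continuation`**:
  for `h ∈ U(J)`, `k : ℤ`, `T = a·hermTwo(t,0,0)·aᴴ` (`‖det a‖ = 1`, `t > 0`) and `N : ℕ` with `k/2 < N`,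
  `∃ E, DifferentiableOn ℂ E {s | 0 < s.re} ∧ ∀ s, ½ < s.re → (twisted block at s) = E s`.

HONEST LABEL: the arch singular row at the scalar type (no `K_w`-type transport, (Φ-S1) open); closes no socket.  HC_CM is proved only modulo the 7
printed citations (2 remaining named inputs: hLiu418 = `stmt-HodgeConjecture-24832`, h413 = `stmt-HodgeConjecture-24833`) until rung 0 closes.

## References
* [Shimura1982] G. Shimura, *Confluent hypergeometric functions on tube domains*, Math. Ann. 260 (1982), §3 Thm. 3.1, §4 Thm. 4.2, (4.3).
* [Shimura1997] G. Shimura, *Euler Products and Eisenstein Series*, CBMS 93 (1997), §16.4, §18.4–18.5.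
-/

set_option autoImplicit false
set_option linter.dupNamespace false

noncomputable section

open Complex MeasureTheory Set Matrix Filter
open scoped ComplexOrder ComplexConjugate Topology

namespace Summit.HodgeConjecture.HodgeConjecture.Cruxes.HLiu418.K2LiuArchTwistedScalarBlockContinuation

open Literature.NumberTheory.ModularForms.SiegelUpperHalfSpace (num denom moeb)
open Summit.HodgeConjecture.HodgeConjecture.Cruxes.HLiu418.K2LiuHermTwoGammaDefs
open Summit.HodgeConjecture.HodgeConjecture.Cruxes.HLiu418.K2LiuHermTwoEtaDefs
open Summit.HodgeConjecture.HodgeConjecture.Cruxes.HLiu418.K2LiuHermTwoConfluentXiDefs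
open Summit.HodgeConjecture.HodgeConjecture.Cruxes.HLiu418.K2LiuHermitianTubeCocycle
open Summit.HodgeConjecture.HodgeConjecture.Cruxes.HLiu418.K2LiuArchInducedTubeDefs
open Summit.HodgeConjecture.HodgeConjecture.Cruxes.HLiu418.K2LiuArchWhittakerLeviEquivariance (integral_comp_hermTwo_conj det_conj_eq trace_mul_conj)
open Summit.HodgeConjecture.HodgeConjecture.Cruxes.HLiu418.K2LiuHermTwoEtaRankOneReduction
open Summit.HodgeConjecture.HodgeConjecture.Cruxes.HLiu418.K2LiuHermTwoEtaRankOneContinuation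
open Summit.HodgeConjecture.HodgeConjecture.Cruxes.HLiu418.K2LiuHermTwoXiEtaIdentitySemidefinite
open Summit.HodgeConjecture.HodgeConjecture.Cruxes.HLiu418.K2LiuHermTwoConfluentXiHolomorphy
open Summit.HodgeConjecture.HodgeConjecture.Cruxes.HLiu418.K2LiuArchTwistedIntertwiningScalarSection
open Summit.HodgeConjecture.HodgeConjecture.Cruxes.HLiu418.K2LiuLocalKernelArchPlaceFactor (differentiableOn_Gamma_two_mul)

/-! ## §1 Unimodular covariance of `η`: `η(g, a T aᴴ; α, β) = η(aᴴ g a, T; α, β)` -/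

/-- **COVARIANCE of `η` under a unimodular congruence of the index**: for `T` hermitian and `‖det a‖ = 1`,
`η(g, a T aᴴ; α, β) = η(aᴴ g a, T; α, β)` (substitution `x ↦ a x aᴴ`, ★ `integral_comp_hermTwo_conj`; sibling of ★ `etaTwo_eq_of_conj_fix`).
[Shimura1982, §4 (4.3)] -/
theorem etaTwo_conj {a T : Matrix (Fin 2) (Fin 2) ℂ} (hT : T.IsHermitian) (hdet : ‖a.det‖ = 1) (g : Matrix (Fin 2) (Fin 2) ℂ) (α β : ℂ) :
    etaTwo g (a * T * aᴴ) α β = etaTwo (aᴴ * g * a) T α β := by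
  have ha : a.det ≠ 0 := fun h0 => by rw [h0, norm_zero] at hdet; exact zero_ne_one hdet
  have haU : IsUnit a := (Matrix.isUnit_iff_isUnit_det a).mpr (Ne.isUnit ha)
  have hT' : (a * T * aᴴ).IsHermitian := isHermitian_mul_mul_conjTranspose a hT
  -- the integrand as a function of the MATRIX, for index `S` and weight `g'`
  set G : Matrix (Fin 2) (Fin 2) ℂ → Matrix (Fin 2) (Fin 2) ℂ → Matrix (Fin 2) (Fin 2) ℂ → ℂ := fun g' S x =>
    {x : Matrix (Fin 2) (Fin 2) ℂ | (x + S).PosDef ∧ (x - S).PosDef}.indicator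
      (fun x => cexp (-(x * g').trace) * ((x + S).det ^ (α - 2) * (x - S).det ^ (β - 2))) x with hG
  have hGc : ∀ (g' S : Matrix (Fin 2) (Fin 2) ℂ) (c : ℝ × ℂ × ℝ), (etaTwoSet S).indicator (etaTwoIntegrand g' S α β) c = G g' S (hermTwo c) := by
    intro g' S c
    by_cases hc : c ∈ etaTwoSet S
    · simp only [hG]
      rw [indicator_of_mem hc, indicator_of_mem (show hermTwo c ∈ {x : Matrix (Fin 2) (Fin 2) ℂ | (x + S).PosDef ∧ (x - S).PosDef} from hc),
        etaTwoIntegrand_apply]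
    · simp only [hG]
      rw [indicator_of_notMem hc, indicator_of_notMem (show hermTwo c ∉ {x : Matrix (Fin 2) (Fin 2) ℂ | (x + S).PosDef ∧ (x - S).PosDef} from hc)]
  have hconj : ∀ x : Matrix (Fin 2) (Fin 2) ℂ, G g (a * T * aᴴ) (a * x * aᴴ) = G (aᴴ * g * a) T x := by
    intro x
    have hadd : a * x * aᴴ + a * T * aᴴ = a * (x + T) * aᴴ := by rw [Matrix.mul_add, Matrix.add_mul]
    have hsub : a * x * aᴴ - a * T * aᴴ = a * (x - T) * aᴴ := by rw [Matrix.mul_sub, Matrix.sub_mul]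
    have hpd : ∀ y : Matrix (Fin 2) (Fin 2) ℂ, (a * y * aᴴ).PosDef ↔ y.PosDef := fun y => by
      rw [← Matrix.star_eq_conjTranspose]
      exact Matrix.IsUnit.posDef_star_right_conjugate_iff haU
    have hdet' : ∀ y : Matrix (Fin 2) (Fin 2) ℂ, (a * y * aᴴ).det = y.det := fun y => by
      rw [det_conj_eq, hdet, one_pow, ofReal_one, one_mul]
    have htr : (a * x * aᴴ * g).trace = (x * (aᴴ * g * a)).trace := by
      rw [Matrix.trace_mul_comm, trace_mul_conj, Matrix.trace_mul_comm]
    by_cases hx : x ∈ {x : Matrix (Fin 2) (Fin 2) ℂ | (x + T).PosDef ∧ (x - T).PosDef}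
    · have hx' : a * x * aᴴ ∈ {x : Matrix (Fin 2) (Fin 2) ℂ | (x + a * T * aᴴ).PosDef ∧ (x - a * T * aᴴ).PosDef} := by
        simp only [mem_setOf_eq] at hx ⊢
        rw [hadd, hsub, hpd, hpd]
        exact hx
      simp only [hG]
      rw [indicator_of_mem hx', indicator_of_mem hx, hadd, hsub, hdet', hdet', htr]
    · have hx' : a * x * aᴴ ∉ {x : Matrix (Fin 2) (Fin 2) ℂ | (x + a * T * aᴴ).PosDef ∧ (x - a * T * aᴴ).PosDef} := by
        simp only [mem_setOf_eq] at hx ⊢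
        rw [hadd, hsub, hpd, hpd]
        exact hx
      simp only [hG]
      rw [indicator_of_notMem hx', indicator_of_notMem hx]
  rw [etaTwo_def, etaTwo_def, ← integral_indicator (measurableSet_etaTwoSet hT'), ← integral_indicator (measurableSet_etaTwoSet hT)]
  simp_rw [hGc]
  rw [integral_comp_hermTwo_conj ha (G g (a * T * aᴴ)), hdet, one_pow, one_smul]
  simp_rw [hconj]

/-! ## §2 Letters: the rank-one index, the weight in coordinates, holomorphic prefactors -/

/-- `a · diag(t, 0) · aᴴ` is positive semidefinite (`t ≥ 0`). [folklore] -/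
theorem posSemidef_conj_rankOne (a : Matrix (Fin 2) (Fin 2) ℂ) {t : ℝ} (ht : 0 ≤ t) : (a * hermTwo (t, 0, 0) * aᴴ).PosSemidef :=
  (posSemidef_hermTwo_rankOne ht).mul_mul_conjTranspose_same a

/-- `π • (a · hermTwo(t,0,0) · aᴴ) = a · hermTwo(πt, 0, 0) · aᴴ`. [folklore] -/
theorem pi_smul_conj_rankOne (a : Matrix (Fin 2) (Fin 2) ℂ) (t : ℝ) :
    (Real.pi : ℂ) • (a * hermTwo (t, 0, 0) * aᴴ) = a * hermTwo (Real.pi * t, 0, 0) * aᴴ := by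
  rw [show ((Real.pi * t, 0, 0) : ℝ × ℂ × ℝ) = Real.pi • (t, 0, 0) by simp [Prod.smul_mk], hermTwo_smul, Matrix.mul_smul, Matrix.smul_mul]

/-- `s ↦ c ^ (u·s + w)` is entire for a non-zero base `c`. [folklore] -/
theorem differentiable_const_cpow_affine {c : ℂ} (hc : c ≠ 0) (u w : ℂ) : Differentiable ℂ (fun s : ℂ => c ^ (u * s + w)) :=
  fun _ => ((((differentiableAt_id).const_mul u).add_const w).const_cpow (Or.inl hc))

/-- `s ↦ Γ(u·s + w)⁻¹` is entire. [folklore] -/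
theorem differentiable_inv_Gamma_affine (u w : ℂ) : Differentiable ℂ (fun s : ℂ => (Complex.Gamma (u * s + w))⁻¹) :=
  Complex.differentiable_one_div_Gamma.comp (((differentiable_id).const_mul u).add_const w)

/-! ## §3 The continuation of the twisted block at a rank-one index -/

/-- **(3c-cont) THE TWISTED ARCHIMEDEAN BIG-CELL BLOCK OF THE SCALAR TYPE AT A RANK-ONE INDEX IS HOLOMORPHIC ON `{0 < re s}`.**  For `h ∈ U(J)`,
`k : ℤ`, a rank-one index `T = a·diag(t,0)·aᴴ` (`‖det a‖ = 1`, `t > 0`) and `N : ℕ` with `k/2 < N`: there is `E` holomorphic on `{0 < re s}` with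
`∫ e(−τ(T·X)) f⁰_{s,k}(J n(X) h) dX = E(s)` for every `s` with `½ < re s` (★ (3c) value `⅛ det d^{−k}|det d|^{k−2s−2} e(τ(TU)) ξ₂(V,T;α,β)`; `ξ₂` is
holomorphic on `{½ < re s}` ★; for `re s ≫ 0` it is `Γ₂(α)⁻¹Γ₂(β)⁻¹η₂` ★, `η₂ = (π/p)e^{−pπt}q′^{−(α+β−2)}Γ(2s)·J` by covariance §1 and ★ ED. 2, and
`Γ(β−1)⁻¹J` continues ★ ED. 3b; identity theorem on the half-plane).  [Shimura1982, §4 Thm. 4.2; §3 Thm. 3.1] [Shimura1997, §18.4] -/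
theorem twistedArchBlock_scalarType_continuation (k : ℤ) {h : Matrix (Fin 2 ⊕ Fin 2) (Fin 2 ⊕ Fin 2) ℂ}
    (hh : hᴴ * Matrix.J (Fin 2) ℂ * h = Matrix.J (Fin 2) ℂ) {a : Matrix (Fin 2) (Fin 2) ℂ} (hdet : ‖a.det‖ = 1) {t : ℝ} (ht : 0 < t)
    {N : ℕ} (hN : (k : ℝ) / 2 < N) :
    ∃ E : ℂ → ℂ, DifferentiableOn ℂ E {s : ℂ | 0 < s.re} ∧ ∀ s : ℂ, 1 / 2 < s.re →
      (∫ r : Fin 2 → Fin 2 → ℝ, cexp (-(2 * Real.pi * I) * ((a * hermTwo (t, 0, 0) * aᴴ) * hermOfReal r).trace) *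
        archScalarSection k s (Matrix.J (Fin 2) ℂ * fromBlocks 1 (hermOfReal r) 0 1 * h)) = E s := by
  -- names
  set T : Matrix (Fin 2) (Fin 2) ℂ := a * hermTwo (t, 0, 0) * aᴴ with hTdef
  set Z : Matrix (Fin 2) (Fin 2) ℂ := moeb h (I • (1 : Matrix (Fin 2) (Fin 2) ℂ)) with hZ
  set d : Matrix (Fin 2) (Fin 2) ℂ := denom h (I • (1 : Matrix (Fin 2) (Fin 2) ℂ)) with hd
  set U : Matrix (Fin 2) (Fin 2) ℂ := (2 : ℂ)⁻¹ • (Z + Zᴴ) with hU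
  set V : Matrix (Fin 2) (Fin 2) ℂ := (2 * I)⁻¹ • (Z - Zᴴ) with hV
  have hδ0 : d.det ≠ 0 := (isUnit_det_denom hh posDef_im_I_smul_one).ne_zero
  have hδpos : 0 < ‖d.det‖ := norm_pos_iff.mpr hδ0
  have hδc : (((‖d.det‖ : ℝ)) : ℂ) ≠ 0 := by exact_mod_cast hδpos.ne'
  have hVpos : V.PosDef := posDef_im_moeb hh posDef_im_I_smul_one
  have hTh : T.IsHermitian := isHermitian_mul_mul_conjTranspose a (isHermitian_hermTwo _)
  have hTpsd : T.PosSemidef := posSemidef_conj_rankOne a ht.le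
  -- the weight `g′ = aᴴ (2V) a > 0` in coordinates
  have ha : a.det ≠ 0 := fun h0 => by rw [h0, norm_zero] at hdet; exact zero_ne_one hdet
  have haU : IsUnit a := (Matrix.isUnit_iff_isUnit_det a).mpr (Ne.isUnit ha)
  have h2V : ((2 : ℂ) • V).PosDef := by
    have h := hVpos.smul (by norm_num : (0 : ℝ) < 2)
    rwa [show ((2 : ℝ) • V) = ((2 : ℂ) • V) by rw [← Complex.coe_smul]; norm_num] at h
  have hg' : (aᴴ * ((2 : ℂ) • V) * a).PosDef := by
    have := Matrix.IsUnit.posDef_star_left_conjugate_iff (x := (2 : ℂ) • V) haU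
    rw [Matrix.star_eq_conjTranspose] at this
    exact this.mpr h2V
  obtain ⟨e, he⟩ : ∃ e : ℝ × ℂ × ℝ, hermTwo e = aᴴ * ((2 : ℂ) • V) * a := ⟨_, hermTwo_eq_of_isHermitian hg'.1⟩
  obtain ⟨hp, hpq⟩ := (posDef_hermTwo_iff e).mp (he.symm ▸ hg')
  obtain ⟨p, w, q⟩ := e
  simp only at hp hpq he
  have hπt : 0 < Real.pi * t := by positivity
  -- the continuation of `Γ(β−1)⁻¹ J` along the K1 line
  obtain ⟨F, hFd, hF⟩ := exists_continuation_jIntegral_line hp hπt N (1 + k / 2) (1 - k / 2)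
  -- the candidate `E`
  refine ⟨fun s => (d.det ^ (-k) * (((‖d.det‖ : ℝ)) : ℂ) ^ ((k : ℂ) - 2 * s - 2) * cexp ((2 * Real.pi * I) * (T * U).trace)) *
      ((1 / 8 : ℂ) * ((((4 * Real.pi ^ 4 : ℝ)) : ℂ) * cexp ((Real.pi * I) * ((s + 1 - k / 2) - (s + 1 + k / 2))) *
        ((Real.pi : ℂ)⁻¹ * (Complex.Gamma (s + 1 + k / 2))⁻¹ * (Complex.Gamma (s + 1 + k / 2 - 1))⁻¹) *
        ((Real.pi : ℂ)⁻¹ * (Complex.Gamma (s + 1 - k / 2))⁻¹) *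
        ((Real.pi : ℂ) / p * cexp (-((p * (Real.pi * t) : ℝ) : ℂ)) *
          ((1 / ((q - normSq w / p : ℝ) : ℂ)) ^ ((s + 1 + k / 2) + (s + 1 - k / 2) - 2) * Complex.Gamma (2 * s)) * F s))), ?_, ?_⟩
  · -- holomorphy on `{0 < re s}`
    have hsub : {s : ℂ | 0 < s.re} ⊆ {s : ℂ | 1 - (N : ℝ) < ((1 - k / 2 : ℂ) + s).re} := by
      intro s hs
      simp only [mem_setOf_eq, add_re, sub_re, one_re, div_ofNat_re, intCast_re] at hs ⊢
      linarith
    have hq0 : (1 / ((q - normSq w / p : ℝ) : ℂ)) ≠ 0 := by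
      have : 0 < q - normSq w / p := by rw [sub_pos, div_lt_iff₀ hp]; linarith
      exact one_div_ne_zero (by exact_mod_cast this.ne')
    have hP : Differentiable ℂ (fun s : ℂ => d.det ^ (-k) * (((‖d.det‖ : ℝ)) : ℂ) ^ ((k : ℂ) - 2 * s - 2) *
        cexp ((2 * Real.pi * I) * (T * U).trace)) := by
      refine ((differentiable_const _).mul fun s => ?_).mul (differentiable_const _)
      exact ((((differentiableAt_const _).sub ((differentiableAt_id).const_mul _)).sub_const _).const_cpow (Or.inl hδc))
    have hC : Differentiable ℂ (fun s : ℂ => (((4 * Real.pi ^ 4 : ℝ)) : ℂ) * cexp ((Real.pi * I) * ((s + 1 - k / 2) - (s + 1 + k / 2))) *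
        ((Real.pi : ℂ)⁻¹ * (Complex.Gamma (s + 1 + k / 2))⁻¹ * (Complex.Gamma (s + 1 + k / 2 - 1))⁻¹) *
        ((Real.pi : ℂ)⁻¹ * (Complex.Gamma (s + 1 - k / 2))⁻¹)) := by
      refine (((differentiable_const _).mul ?_).mul ?_).mul ?_
      · exact (((differentiable_const _).mul ((((differentiable_id).add_const _).sub_const _).sub
          (((differentiable_id).add_const _).add_const _)))).cexp
      · refine ((differentiable_const _).mul ?_).mul ?_
        · exact Complex.differentiable_one_div_Gamma.comp (((differentiable_id).add_const _).add_const _)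
        · exact Complex.differentiable_one_div_Gamma.comp ((((differentiable_id).add_const _).add_const _).sub_const _)
      · exact (differentiable_const _).mul (Complex.differentiable_one_div_Gamma.comp (((differentiable_id).add_const _).sub_const _))
    have hR : DifferentiableOn ℂ (fun s : ℂ => (Real.pi : ℂ) / p * cexp (-((p * (Real.pi * t) : ℝ) : ℂ)) *
        ((1 / ((q - normSq w / p : ℝ) : ℂ)) ^ ((s + 1 + k / 2) + (s + 1 - k / 2) - 2) * Complex.Gamma (2 * s))) {s : ℂ | 0 < s.re} := by
      refine ((differentiableOn_const _).mul ?_)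
      refine DifferentiableOn.mul (fun s _ => ?_) differentiableOn_Gamma_two_mul
      exact (((((differentiableAt_id).add_const _).add_const _).add (((differentiableAt_id).add_const _).sub_const _)).sub_const _
        |>.const_cpow (Or.inl hq0)).differentiableWithinAt
    exact hP.differentiableOn.mul (((differentiableOn_const _).mul (hC.differentiableOn.mul (hR.mul (hFd.mono hsub)))))
  · -- the value on `{½ < re s}`: both sides are holomorphic there and agree for `re s ≫ 0`
    -- (i) the block as a function of `s`, via ★ (3c)
    have hB : ∀ s : ℂ, (∫ r : Fin 2 → Fin 2 → ℝ, cexp (-(2 * Real.pi * I) * (T * hermOfReal r).trace) *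
        archScalarSection k s (Matrix.J (Fin 2) ℂ * fromBlocks 1 (hermOfReal r) 0 1 * h)) =
        (d.det ^ (-k) * (((‖d.det‖ : ℝ)) : ℂ) ^ ((k : ℂ) - 2 * s - 2) * cexp ((2 * Real.pi * I) * (T * U).trace)) *
          ((1 / 8 : ℂ) * xiTwo V T ((1 + k / 2) + s) ((1 - k / 2) + s)) := by
      intro s
      rw [twistedArchIntertwining_archScalarSection_eq k s hh T, ← hZ, ← hd]
      rw [show (1 + (k : ℂ) / 2) + s = s + 1 + k / 2 by ring, show (1 - (k : ℂ) / 2) + s = s + 1 - k / 2 by ring]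
    -- (ii) holomorphy of the block on the half-plane `{½ < re s}`
    have hPd : Differentiable ℂ (fun s : ℂ => d.det ^ (-k) * (((‖d.det‖ : ℝ)) : ℂ) ^ ((k : ℂ) - 2 * s - 2) *
        cexp ((2 * Real.pi * I) * (T * U).trace)) := by
      refine ((differentiable_const _).mul fun s => ?_).mul (differentiable_const _)
      exact ((((differentiableAt_const _).sub ((differentiableAt_id).const_mul _)).sub_const _).const_cpow (Or.inl hδc))
    have hXi : DifferentiableOn ℂ (fun s : ℂ => xiTwo V T ((1 + k / 2) + s) ((1 - k / 2) + s)) {s : ℂ | 1 / 2 < s.re} := by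
      refine (differentiableOn_xiTwo_diag hVpos hTh (1 + k / 2) (1 - k / 2)).mono fun s hs => ?_
      simp only [mem_setOf_eq, add_re, sub_re, one_re, div_ofNat_re, intCast_re, mul_re, re_ofNat, im_ofNat, zero_mul, sub_zero] at hs ⊢
      linarith
    have hBd : DifferentiableOn ℂ (fun s : ℂ => ∫ r : Fin 2 → Fin 2 → ℝ, cexp (-(2 * Real.pi * I) * (T * hermOfReal r).trace) *
        archScalarSection k s (Matrix.J (Fin 2) ℂ * fromBlocks 1 (hermOfReal r) 0 1 * h)) {s : ℂ | 1 / 2 < s.re} := by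
      have e : (fun s : ℂ => ∫ r : Fin 2 → Fin 2 → ℝ, cexp (-(2 * Real.pi * I) * (T * hermOfReal r).trace) *
          archScalarSection k s (Matrix.J (Fin 2) ℂ * fromBlocks 1 (hermOfReal r) 0 1 * h)) =
          fun s => (d.det ^ (-k) * (((‖d.det‖ : ℝ)) : ℂ) ^ ((k : ℂ) - 2 * s - 2) * cexp ((2 * Real.pi * I) * (T * U).trace)) *
            ((1 / 8 : ℂ) * xiTwo V T ((1 + k / 2) + s) ((1 - k / 2) + s)) := funext hB
      rw [e]
      exact hPd.differentiableOn.mul ((differentiableOn_const _).mul hXi)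
    -- (iii) the agreement for `re s > |k| + 3`
    have hagree : ∀ s : ℂ, (|(k : ℝ)| + 3) < s.re →
        (∫ r : Fin 2 → Fin 2 → ℝ, cexp (-(2 * Real.pi * I) * (T * hermOfReal r).trace) *
          archScalarSection k s (Matrix.J (Fin 2) ℂ * fromBlocks 1 (hermOfReal r) 0 1 * h)) =
        (d.det ^ (-k) * (((‖d.det‖ : ℝ)) : ℂ) ^ ((k : ℂ) - 2 * s - 2) * cexp ((2 * Real.pi * I) * (T * U).trace)) *
          ((1 / 8 : ℂ) * ((((4 * Real.pi ^ 4 : ℝ)) : ℂ) * cexp ((Real.pi * I) * ((s + 1 - k / 2) - (s + 1 + k / 2))) *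
            ((Real.pi : ℂ)⁻¹ * (Complex.Gamma (s + 1 + k / 2))⁻¹ * (Complex.Gamma (s + 1 + k / 2 - 1))⁻¹) *
            ((Real.pi : ℂ)⁻¹ * (Complex.Gamma (s + 1 - k / 2))⁻¹) *
            ((Real.pi : ℂ) / p * cexp (-((p * (Real.pi * t) : ℝ) : ℂ)) *
              ((1 / ((q - normSq w / p : ℝ) : ℂ)) ^ ((s + 1 + k / 2) + (s + 1 - k / 2) - 2) * Complex.Gamma (2 * s)) * F s))) := by
      intro s hs
      have hk1 : -( |(k : ℝ)| ) ≤ (k : ℝ) ∧ (k : ℝ) ≤ |(k : ℝ)| := ⟨neg_abs_le _, le_abs_self _⟩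
      have hα : 3 < (s + 1 + (k : ℂ) / 2).re := by
        simp only [add_re, one_re, div_ofNat_re, intCast_re]; linarith [hk1.1]
      have hβ : 1 < (s + 1 - (k : ℂ) / 2).re := by
        simp only [add_re, sub_re, one_re, div_ofNat_re, intCast_re]; linarith [hk1.2]
      have hαβ : 3 < ((s + 1 + (k : ℂ) / 2) + (s + 1 - (k : ℂ) / 2)).re := by
        simp only [add_re, sub_re, one_re, div_ofNat_re, intCast_re]; linarith
      have hβline : 1 < ((1 - (k : ℂ) / 2) + s).re := by
        simp only [add_re, sub_re, one_re, div_ofNat_re, intCast_re]; linarith [hk1.2]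
      -- ξ → η, rotate the index, reduce
      rw [hB s, show (1 + (k : ℂ) / 2) + s = s + 1 + k / 2 by ring, show (1 - (k : ℂ) / 2) + s = s + 1 - k / 2 by ring,
        xiTwo_eq_etaTwo_of_posSemidef hVpos hTpsd hα hβ, hTdef, pi_smul_conj_rankOne a t,
        etaTwo_conj (isHermitian_hermTwo _) hdet ((2 : ℂ) • V), ← he, etaTwo_rankOne_eq hp hpq hπt hβ hαβ]
      -- the continued letter
      have hFs := hF s hβline
      rw [show (1 - (k : ℂ) / 2) + s - 1 = s + 1 - k / 2 - 1 by ring, show (1 + (k : ℂ) / 2) + s - 2 = s + 1 + k / 2 - 2 by ring,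
        show (1 - (k : ℂ) / 2) + s - 2 = s + 1 - k / 2 - 2 by ring] at hFs
      rw [hFs]
      -- `Γ₂(β)⁻¹ = π⁻¹ Γ(β)⁻¹ Γ(β−1)⁻¹`, `Γ₂(α)⁻¹ = π⁻¹ Γ(α)⁻¹ Γ(α−1)⁻¹`, `α + β − 2 = 2s`
      rw [hermTwoGamma_def, hermTwoGamma_def, mul_inv, mul_inv, mul_inv, mul_inv,
        show (s + 1 + (k : ℂ) / 2) + (s + 1 - (k : ℂ) / 2) - 2 = 2 * s by ring]
      ring
    -- (iv) identity theorem on the half-plane `{½ < re s}`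
    have hUo : IsOpen {s : ℂ | 1 / 2 < s.re} := isOpen_lt continuous_const Complex.continuous_re
    have hUc : IsPreconnected {s : ℂ | 1 / 2 < s.re} := (convex_halfSpace_re_gt (1 / 2)).isPreconnected
    set z₀ : ℂ := (((|(k : ℝ)| + 4 : ℝ)) : ℂ) with hz₀
    have hz₀U : z₀ ∈ {s : ℂ | 1 / 2 < s.re} := by
      simp only [mem_setOf_eq, hz₀, ofReal_re]; linarith [abs_nonneg (k : ℝ)]
    have hEd : DifferentiableOn ℂ (fun s => (d.det ^ (-k) * (((‖d.det‖ : ℝ)) : ℂ) ^ ((k : ℂ) - 2 * s - 2) * cexp ((2 * Real.pi * I) * (T * U).trace)) *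
      ((1 / 8 : ℂ) * ((((4 * Real.pi ^ 4 : ℝ)) : ℂ) * cexp ((Real.pi * I) * ((s + 1 - k / 2) - (s + 1 + k / 2))) *
        ((Real.pi : ℂ)⁻¹ * (Complex.Gamma (s + 1 + k / 2))⁻¹ * (Complex.Gamma (s + 1 + k / 2 - 1))⁻¹) *
        ((Real.pi : ℂ)⁻¹ * (Complex.Gamma (s + 1 - k / 2))⁻¹) *
        ((Real.pi : ℂ) / p * cexp (-((p * (Real.pi * t) : ℝ) : ℂ)) *
          ((1 / ((q - normSq w / p : ℝ) : ℂ)) ^ ((s + 1 + k / 2) + (s + 1 - k / 2) - 2) * Complex.Gamma (2 * s)) * F s)))) {s : ℂ | 1 / 2 < s.re} := by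
      -- the candidate is holomorphic on `{0 < re}` (first bullet, re-derived) hence on `{½ < re}`
      have hsub : {s : ℂ | 1 / 2 < s.re} ⊆ {s : ℂ | 1 - (N : ℝ) < ((1 - k / 2 : ℂ) + s).re} := by
        intro s hs
        simp only [mem_setOf_eq, add_re, sub_re, one_re, div_ofNat_re, intCast_re] at hs ⊢
        linarith
      have hsub0 : {s : ℂ | 1 / 2 < s.re} ⊆ {s : ℂ | 0 < s.re} := fun s hs => by
        simp only [mem_setOf_eq] at hs ⊢; linarith
      have hq0 : (1 / ((q - normSq w / p : ℝ) : ℂ)) ≠ 0 := by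
        have : 0 < q - normSq w / p := by rw [sub_pos, div_lt_iff₀ hp]; linarith
        exact one_div_ne_zero (by exact_mod_cast this.ne')
      have hC : Differentiable ℂ (fun s : ℂ => (((4 * Real.pi ^ 4 : ℝ)) : ℂ) * cexp ((Real.pi * I) * ((s + 1 - k / 2) - (s + 1 + k / 2))) *
          ((Real.pi : ℂ)⁻¹ * (Complex.Gamma (s + 1 + k / 2))⁻¹ * (Complex.Gamma (s + 1 + k / 2 - 1))⁻¹) *
          ((Real.pi : ℂ)⁻¹ * (Complex.Gamma (s + 1 - k / 2))⁻¹)) := by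
        refine (((differentiable_const _).mul ?_).mul ?_).mul ?_
        · exact (((differentiable_const _).mul ((((differentiable_id).add_const _).sub_const _).sub
            (((differentiable_id).add_const _).add_const _)))).cexp
        · refine ((differentiable_const _).mul ?_).mul ?_
          · exact Complex.differentiable_one_div_Gamma.comp (((differentiable_id).add_const _).add_const _)
          · exact Complex.differentiable_one_div_Gamma.comp ((((differentiable_id).add_const _).add_const _).sub_const _)
        · exact (differentiable_const _).mul (Complex.differentiable_one_div_Gamma.comp (((differentiable_id).add_const _).sub_const _))
      have hR : DifferentiableOn ℂ (fun s : ℂ => (Real.pi : ℂ) / p * cexp (-((p * (Real.pi * t) : ℝ) : ℂ)) *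
          ((1 / ((q - normSq w / p : ℝ) : ℂ)) ^ ((s + 1 + k / 2) + (s + 1 - k / 2) - 2) * Complex.Gamma (2 * s))) {s : ℂ | 1 / 2 < s.re} := by
        refine ((differentiableOn_const _).mul ?_)
        refine DifferentiableOn.mul (fun s _ => ?_) (differentiableOn_Gamma_two_mul.mono hsub0)
        exact (((((differentiableAt_id).add_const _).add_const _).add (((differentiableAt_id).add_const _).sub_const _)).sub_const _
          |>.const_cpow (Or.inl hq0)).differentiableWithinAt
      exact hPd.differentiableOn.mul (((differentiableOn_const _).mul (hC.differentiableOn.mul (hR.mul (hFd.mono hsub)))))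
    have hev : (fun s : ℂ => ∫ r : Fin 2 → Fin 2 → ℝ, cexp (-(2 * Real.pi * I) * (T * hermOfReal r).trace) *
          archScalarSection k s (Matrix.J (Fin 2) ℂ * fromBlocks 1 (hermOfReal r) 0 1 * h)) =ᶠ[𝓝 z₀]
        (fun s => (d.det ^ (-k) * (((‖d.det‖ : ℝ)) : ℂ) ^ ((k : ℂ) - 2 * s - 2) * cexp ((2 * Real.pi * I) * (T * U).trace)) *
          ((1 / 8 : ℂ) * ((((4 * Real.pi ^ 4 : ℝ)) : ℂ) * cexp ((Real.pi * I) * ((s + 1 - k / 2) - (s + 1 + k / 2))) *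
            ((Real.pi : ℂ)⁻¹ * (Complex.Gamma (s + 1 + k / 2))⁻¹ * (Complex.Gamma (s + 1 + k / 2 - 1))⁻¹) *
            ((Real.pi : ℂ)⁻¹ * (Complex.Gamma (s + 1 - k / 2))⁻¹) *
            ((Real.pi : ℂ) / p * cexp (-((p * (Real.pi * t) : ℝ) : ℂ)) *
              ((1 / ((q - normSq w / p : ℝ) : ℂ)) ^ ((s + 1 + k / 2) + (s + 1 - k / 2) - 2) * Complex.Gamma (2 * s)) * F s)))) := by
      have hopen : IsOpen {s : ℂ | (|(k : ℝ)| + 3) < s.re} := isOpen_lt continuous_const Complex.continuous_re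
      have hmem : z₀ ∈ {s : ℂ | (|(k : ℝ)| + 3) < s.re} := by
        simp only [mem_setOf_eq, hz₀, ofReal_re]; linarith
      filter_upwards [hopen.mem_nhds hmem] with s hs
      exact hagree s hs
    intro s hs
    exact (hBd.analyticOnNhd hUo).eqOn_of_preconnected_of_eventuallyEq (hEd.analyticOnNhd hUo) hUc hz₀U hev hs

end Summit.HodgeConjecture.HodgeConjecture.Cruxes.HLiu418.K2LiuArchTwistedScalarBlockContinuation

end
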